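import Summits.BirchSwinnertonDyer.Rank1Residual.P2.CongruentNumberTwoPrimeSevenModEightMonskyDescent
import Literature.NumberTheory.EllipticCurves.Tian2014.CMPointSystemDescentPrimeSevenOdd
import HarnessLib

/-!
# Cell «bsd-monsky» (prover-A, g13): ROUTE A AT ONE PRIME, the ODD twist — `N = p ≡ 7 (mod 8)` (Monsky's `p₇`, Cor. 5.15 (1)),
# from Tian's printed CM-point system plus the printed sentences on `√2`: Tian Prop. 4.6 = Monsky Thm. 4.9 for Tian's
# odd-twist point `2y_p`; rank `E_p(ℚ) = 1`, `p` congruent, `Ш(E_p)[2^∞] = 0`, odd index — and Monsky's Cor. 5.15 (1)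
# minus `p₅` («`p₇`, `2p₇`, `2p₃`») for Tian's points from the printed binders

HONEST FRAMING (cell `bsd-monsky`, run/shared/lean/pub/bsd-monsky/, README §1: ONE theorem on ONE explicit infinite
family at the prime `2`; nothing booked). This file asserts NO arithmetic fact and claims NOTHING new on paper: that every
prime `p ≡ 7 (mod 8)` is a congruent number is classical (Monsky 1990 Thm. 4.9 / Cor. 5.15 (1) «`p₇`»; Tian 2014 Prop. 4.6
«proved in [19]»). It records, from the PRINTED SYSTEM BINDER
`hSk₇ : ∀ p ≡ 7 (8) prime, ∃ D : CMPointData p, D.Printed ∧ (√2 ∈ H) ∧ (σ_{1+ϖ} fixes √2) ∧ (conj fixes √2) ∧ (σ_{ϖ′} fixes √2) ∧ (σ_t moves √2 for [t] ∉ 2𝒜)`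
(Tian Thm. 2.8 (1)–(3), (4.8), the Galois facts, and the five sentences of §4.2 / Prop. 4.6's proof on `√2 ∈ H₀ ⊂ H` —
binder form, no new named fact; no Gross–Zagier display, no `2`-Selmer display):
* (M-2y, odd twist) `θ′ = √−2p/√2 = √−p ∈ H`, a transversal `φ` of `𝒜/[ϖ′]`, and for EVERY transversal a RATIONAL point
  `y″ ∈ E_p(ℚ)` with `transfer_{θ′} y″ = 2y_{p,φ}` (the signed sum `Σ_φ χ_p(t) z_t`) and `y″ ∉ 2E_p(ℚ) + E_p(ℚ)_tor`
  (`Tian2014.CMPointData.exists_transferE_eq_two_nsmul_yPointChi_not_two_smul_add_torsion_prime_seven_mod_eight`);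
* rank `E_p(ℚ) = 1` (`≤ 1` = «`S̄ = ℤ/2`» on the Cor. 5.15 family `p₇`, p528474); `p` congruent; `Ш(E_p)[2^∞] = 0`;
  `y″` has ODD INDEX against every generator of `E_p(ℚ)/tor`;
* **Monsky's Theorem 4.9 in full for Tian's points** (`p₇` and `2p₇` from the same binder) and **Cor. 5.15 (1) minus `p₅`**
  (`2p₃` from the `p ≡ 3 (8)` binder of `CongruentNumberTwoPrimeThreeModEightMonskyDescent`): rank one and congruent.
In the tree `p₇` was so far reached through TYZ's genus-point criterion (DOOR A, relative to {`tyz_genusPointData`, GZK}); this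
is a second, Gross–Zagier-free proof of rank one there. Nothing is asserted unconditionally beyond the tree's own descent theorems.
[cite: Tian2014, Prop. 4.6 (arXiv:1210.8231 p0023 L15–L22) and its proof (p0023 L26–p0024 L30), §4.2 (p0022 L47–L71)]
[cite: Monsky1990MockHeegner, Thm. 4.5 (p. 57), Thm. 4.6 (p. 57), Lemma 4.8 and Thm. 4.9 (p. 58), Cor. 5.15 (1) (p. 66), Remark (2) (p. 67)]
[cite: SilvermanAEC2009, Thm. X.4.2, Thm. VIII.6.7] [cite: TopYui2008Congruent, Prop. 3.3 (i) ⟺ (iv)]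
-/

noncomputable section

open scoped Classical NumberTheorySymbols

open WeierstrassCurve NumberField Literature.NumberTheory.EllipticCurves
  Literature.NumberTheory.EllipticCurves.Rank1Residual
  Literature.NumberTheory.EllipticCurves.Rank1Residual.Typed
  Literature.NumberTheory.EllipticCurves.Monsky1990
  Literature.NumberTheory.EllipticCurves.TianYuanZhang2017

set_option autoImplicit false

namespace Summit.BirchSwinnertonDyer.Rank1Residual.P2

open Conjectures Literature.NumberTheory.EllipticCurves.Tian2014

/-! ## §1 The family `p₇` is a Cor. 5.15 family -/

/-- **A prime `p ≡ 7 (8)` is Monsky's family `p₇` of Cor. 5.15 (1)**. [cite: Monsky1990MockHeegner, Cor. 5.15 (1) (p. 66)] -/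
theorem isCor515Family_prime_seven_mod_eight {p : ℕ} (hp : p.Prime) (hp8 : p % 8 = 7) : IsCor515Family p :=
  Or.inl ⟨hp, Or.inr hp8⟩

/-! ## §2 Rank one, congruent, `Ш[2^∞] = 0` and the odd index on `p₇` from the printed system binder -/

/-- **Rank `E_p(ℚ) = 1` for every prime `p ≡ 7 (mod 8)` from the printed system binder alone** (Tian Prop. 4.6 = Monsky
Thm. 4.9, odd twist, transplanted: `2y_p` is the transfer of a rational point `y″ ∉ 2E + tor`, so `rank ≥ 1`; `rank ≤ 1` is
the tree's exact count `#Sel₂(E_p) = 8` on the Cor. 5.15 family `p₇`). No Gross–Zagier input.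
[cite: Tian2014, Prop. 4.6 (p0023 L15–L22)] [cite: Monsky1990MockHeegner, Thm. 4.9 (p. 58), Cor. 5.15 (1) (p. 66)]
[cite: SilvermanAEC2009, Thm. X.4.2] -/
theorem mordellWeilRank_eq_one_prime_seven_mod_eight_of_printed
    (hSk₇ : ∀ p : ℕ, p.Prime → p % 8 = 7 →
      ∃ D : CMPointData p, D.Printed ∧ (∃ s : D.H, s ^ 2 = 2) ∧ (∀ s : D.H, s ^ 2 = 2 → D.tau s = s) ∧
        (∀ s : D.H, s ^ 2 = 2 → D.conj s = s) ∧ (∀ s : D.H, s ^ 2 = 2 → D.art D.piPrime s = s) ∧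
        ∀ t : ClassGroup (𝓞 (GenusField (2 * p))), ¬ IsSquare t → ∀ s : D.H, s ^ 2 = 2 → D.art t s = -s) :
    ∀ p : ℕ, p.Prime → p % 8 = 7 → (congruentNumberCurve p).mordellWeilRank = 1 := by
  intro p hp hp8
  have hN : IsCor515Family p := isCor515Family_prime_seven_mod_eight hp hp8
  haveI := isElliptic_congruentNumberCurve hN.ne_zero
  obtain ⟨D, hP, hsq2, hτ2, hc2, hπ2, hgen⟩ := hSk₇ p hp hp8
  obtain ⟨θ', hθ', hθ'0, ⟨φ, hφ⟩, hall⟩ :=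
    D.exists_transferE_eq_two_nsmul_yPointChi_not_two_smul_add_torsion_prime_seven_mod_eight hp hp8 hP hsq2 hτ2 hc2
      hπ2 hgen
  obtain ⟨y'', -, hnot⟩ := hall φ hφ
  exact le_antisymm (mordellWeilRank_le_one_of_isCor515Family hN)
    (Nat.one_le_iff_ne_zero.mpr (mordellWeilRank_ne_zero_of_not_two_smul_add_torsion hN.ne_zero y'' hnot))

/-- **Every prime `p ≡ 7 (mod 8)` is a congruent number from the printed system binder alone** (Cor. 5.15 (1) «`p₇`»).
[cite: Tian2014, Prop. 4.6 (p0023 L20–L22)] [cite: Monsky1990MockHeegner, Cor. 5.15 (1) (p. 66)]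
[cite: TopYui2008Congruent, Prop. 3.3 (i) ⟺ (iv)] -/
theorem isCongruentNumber_prime_seven_mod_eight_of_printed
    (hSk₇ : ∀ p : ℕ, p.Prime → p % 8 = 7 →
      ∃ D : CMPointData p, D.Printed ∧ (∃ s : D.H, s ^ 2 = 2) ∧ (∀ s : D.H, s ^ 2 = 2 → D.tau s = s) ∧
        (∀ s : D.H, s ^ 2 = 2 → D.conj s = s) ∧ (∀ s : D.H, s ^ 2 = 2 → D.art D.piPrime s = s) ∧
        ∀ t : ClassGroup (𝓞 (GenusField (2 * p))), ¬ IsSquare t → ∀ s : D.H, s ^ 2 = 2 → D.art t s = -s) :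
    ∀ p : ℕ, p.Prime → p % 8 = 7 → IsCongruentNumber p :=
  fun p hp hp8 =>
    (Wiles2000.mordellWeilRank_ne_zero_iff_isCongruentNumber hp.pos).mp
      (by rw [mordellWeilRank_eq_one_prime_seven_mod_eight_of_printed hSk₇ p hp hp8]; exact one_ne_zero)

/-- **`Ш(E_p)[2^∞] = 0` for every prime `p ≡ 7 (mod 8)` from the printed system binder alone** (rank one and the exact count
`#Sel₂(E_p) = 8`). [cite: Monsky1990MockHeegner, Remark (2) (p. 67)] [cite: SilvermanAEC2009, Thm. X.4.2] -/
theorem primaryComponent_sha_two_eq_bot_prime_seven_mod_eight_of_printed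
    (hSk₇ : ∀ p : ℕ, p.Prime → p % 8 = 7 →
      ∃ D : CMPointData p, D.Printed ∧ (∃ s : D.H, s ^ 2 = 2) ∧ (∀ s : D.H, s ^ 2 = 2 → D.tau s = s) ∧
        (∀ s : D.H, s ^ 2 = 2 → D.conj s = s) ∧ (∀ s : D.H, s ^ 2 = 2 → D.art D.piPrime s = s) ∧
        ∀ t : ClassGroup (𝓞 (GenusField (2 * p))), ¬ IsSquare t → ∀ s : D.H, s ^ 2 = 2 → D.art t s = -s) :
    ∀ p : ℕ, (hp : p.Prime) → p % 8 = 7 →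
      haveI := isElliptic_congruentNumberCurve (n := p) hp.ne_zero
      AddCommGroup.primaryComponent (congruentNumberCurve p).sha 2 = ⊥ := by
  intro p hp hp8
  have hN : IsCor515Family p := isCor515Family_prime_seven_mod_eight hp hp8
  have h := (isCongruentNumber_iff_primaryComponent_sha_two_eq_bot_of_isCor515Family hN).mp
    (isCongruentNumber_prime_seven_mod_eight_of_printed hSk₇ p hp hp8)
  convert h

/-- **MONSKY'S THEOREM 4.9 (ODD TWIST) FOR TIAN'S POINT `2y_p`, `p ≡ 7 (mod 8)`, from the printed system binder alone**: for
every such `p` and printed system `D` there are `θ′ = √−p ∈ H(i)` and a transversal `φ` of `𝒜/[ϖ′]`, and for EVERY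
transversal a rational point `y″ ∈ E_p(ℚ)` with `transfer_{θ′} y″ = 2y_{p,φ}`, of INFINITE ORDER and ODD INDEX against every
generator of `E_p(ℚ)/tor`. No `L`-function, no Gross–Zagier display, no `2`-Selmer display.
[cite: Tian2014, Prop. 4.6 (p0023 L15–L22)] [cite: Monsky1990MockHeegner, Thm. 4.9 (p. 58)] -/
theorem monskyOddIndex_prime_seven_mod_eight_of_printed
    (hSk₇ : ∀ p : ℕ, p.Prime → p % 8 = 7 →
      ∃ D : CMPointData p, D.Printed ∧ (∃ s : D.H, s ^ 2 = 2) ∧ (∀ s : D.H, s ^ 2 = 2 → D.tau s = s) ∧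
        (∀ s : D.H, s ^ 2 = 2 → D.conj s = s) ∧ (∀ s : D.H, s ^ 2 = 2 → D.art D.piPrime s = s) ∧
        ∀ t : ClassGroup (𝓞 (GenusField (2 * p))), ¬ IsSquare t → ∀ s : D.H, s ^ 2 = 2 → D.art t s = -s) :
    ∀ p : ℕ, p.Prime → p % 8 = 7 →
      ∃ D : CMPointData p, D.Printed ∧
        ∃ (θ' : D.H) (hθ' : θ' ^ 2 = algebraMap ℚ D.H (-(p : ℚ))) (hθ'0 : θ' ≠ 0),
          (∃ φ, D.IsRepsModPiPrime φ) ∧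
          ∀ φ : Finset (ClassGroup (𝓞 (GenusField (2 * p)))), D.IsRepsModPiPrime φ →
            ∃ y'' : (congruentNumberCurve p).toAffine.Point,
              transferE p θ' hθ' hθ'0 y'' = (2 : ℕ) • D.yPointChi θ' φ ∧ ¬ IsOfFinAddOrder y'' ∧
              (∀ g : (congruentNumberCurve p).toAffine.Point, GeneratesFreePartRat p g →
                ∃ m : ℤ, Odd m ∧ IsOfFinAddOrder (y'' - m • g)) := by
  intro p hp hp8
  obtain ⟨D, hP, hsq2, hτ2, hc2, hπ2, hgen⟩ := hSk₇ p hp hp8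
  obtain ⟨θ', hθ', hθ'0, hex, hall⟩ :=
    D.exists_transferE_eq_two_nsmul_yPointChi_not_two_smul_add_torsion_prime_seven_mod_eight hp hp8 hP hsq2 hτ2 hc2
      hπ2 hgen
  refine ⟨D, hP, θ', hθ', hθ'0, hex, fun φ hφ => ?_⟩
  obtain ⟨y'', hy'', hnot⟩ := hall φ hφ
  exact ⟨y'', hy'', not_isOfFinAddOrder_of_not_two_smul_add_torsion y'' hnot,
    fun g hg => exists_odd_isOfFinAddOrder_sub_zsmul_of_not_two_smul_add_torsion y'' hnot g hg⟩

/-! ## §3 Monsky's Theorem 4.9 in full, and Cor. 5.15 (1) minus `p₅`, for Tian's points -/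

/-- **Monsky's Theorem 4.9 in FULL for Tian's points, from ONE printed binder**: for every prime `p ≡ 7 (mod 8)` both
`N = p` and `N = 2p` have rank one and are congruent numbers ("neither `2S_{p₇}` nor `2S_{2p₇}` is in `T`. In fact
`2S_{p₇} ∉ 2Λ_{p₇} + T` and `2S_{2p₇} ∉ 2Λ_{2p₇} + T"). [cite: Monsky1990MockHeegner, Thm. 4.9 (p. 58), Cor. 5.15 (1) (p. 66)]
[cite: Tian2014, Prop. 4.6 (p0023 L15–L22)] -/
theorem monsky_thm49_both_twists_of_printed
    (hSk₇ : ∀ p : ℕ, p.Prime → p % 8 = 7 →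
      ∃ D : CMPointData p, D.Printed ∧ (∃ s : D.H, s ^ 2 = 2) ∧ (∀ s : D.H, s ^ 2 = 2 → D.tau s = s) ∧
        (∀ s : D.H, s ^ 2 = 2 → D.conj s = s) ∧ (∀ s : D.H, s ^ 2 = 2 → D.art D.piPrime s = s) ∧
        ∀ t : ClassGroup (𝓞 (GenusField (2 * p))), ¬ IsSquare t → ∀ s : D.H, s ^ 2 = 2 → D.art t s = -s) :
    ∀ p : ℕ, p.Prime → p % 8 = 7 →
      ((congruentNumberCurve p).mordellWeilRank = 1 ∧ IsCongruentNumber p) ∧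
      ((congruentNumberCurve (2 * p)).mordellWeilRank = 1 ∧ IsCongruentNumber (2 * p)) := by
  intro p hp hp8
  have hSk₇' : ∀ q : ℕ, q.Prime → q % 8 = 7 →
      ∃ D : CMPointData q, D.Printed ∧ (∀ s : D.H, s ^ 2 = 2 → D.tau s = s) ∧
        ∀ t : ClassGroup (𝓞 (GenusField (2 * q))), ¬ IsSquare t → ∀ s : D.H, s ^ 2 = 2 → D.art t s = -s :=
    fun q hq hq8 => by
      obtain ⟨D, hP, -, hτ2, -, -, hgen⟩ := hSk₇ q hq hq8
      exact ⟨D, hP, hτ2, hgen⟩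
  exact ⟨⟨mordellWeilRank_eq_one_prime_seven_mod_eight_of_printed hSk₇ p hp hp8,
      isCongruentNumber_prime_seven_mod_eight_of_printed hSk₇ p hp hp8⟩,
    mordellWeilRank_eq_one_two_mul_seven_mod_eight_of_printed hSk₇' p hp hp8,
    isCongruentNumber_two_mul_seven_mod_eight_of_printed hSk₇' p hp hp8⟩

/-- **Monsky's Cor. 5.15 (1) minus `p₅` («`p₇`, `2p₇`, `2p₃`») for Tian's points, from the two printed binders**: rank one
and congruent on `p₇`, `2p₇` (Thm. 4.9) and `2p₃` (Thm. 4.6). `p₅` is outside the `n ≡ 3 (mod 4)` data of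
`CMPointSystemDisplays` (Tian's `n ≡ 1 (mod 4)` construction) and is not touched.
[cite: Monsky1990MockHeegner, Thm. 4.6 (p. 57), Thm. 4.9 (p. 58), Cor. 5.15 (1) (p. 66)] [cite: Tian2014, Prop. 4.6 (p0023 L15–L22)] -/
theorem cor515_one_minus_five_of_printed
    (hSk₁ : ∀ p : ℕ, p.Prime → p % 8 = 3 →
      ∃ D : CMPointData p, D.Printed ∧ ∀ s : D.H, s ^ 2 = 2 → D.tau s = s)
    (hSk₇ : ∀ p : ℕ, p.Prime → p % 8 = 7 →
      ∃ D : CMPointData p, D.Printed ∧ (∃ s : D.H, s ^ 2 = 2) ∧ (∀ s : D.H, s ^ 2 = 2 → D.tau s = s) ∧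
        (∀ s : D.H, s ^ 2 = 2 → D.conj s = s) ∧ (∀ s : D.H, s ^ 2 = 2 → D.art D.piPrime s = s) ∧
        ∀ t : ClassGroup (𝓞 (GenusField (2 * p))), ¬ IsSquare t → ∀ s : D.H, s ^ 2 = 2 → D.art t s = -s) :
    (∀ p : ℕ, p.Prime → p % 8 = 7 →
      ((congruentNumberCurve p).mordellWeilRank = 1 ∧ IsCongruentNumber p) ∧
      ((congruentNumberCurve (2 * p)).mordellWeilRank = 1 ∧ IsCongruentNumber (2 * p))) ∧
    ∀ p : ℕ, p.Prime → p % 8 = 3 →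
      (congruentNumberCurve (2 * p)).mordellWeilRank = 1 ∧ IsCongruentNumber (2 * p) :=
  ⟨monsky_thm49_both_twists_of_printed hSk₇, fun p hp hp8 =>
    ⟨mordellWeilRank_eq_one_two_mul_three_mod_eight_of_printed hSk₁ p hp hp8,
      isCongruentNumber_two_mul_three_mod_eight_of_printed hSk₁ p hp hp8⟩⟩

end Summit.BirchSwinnertonDyer.Rank1Residual.P2

end
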